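import Literature.NumberTheory.LFunctions.SelbergSigmaXT
import Literature.NumberTheory.LFunctions.SelbergMeanSquareEngine
import Literature.NumberTheory.LFunctions.SelbergPrimeSumEstimates
import HarnessLib

/-!
# Selberg's approximate formula for `S(t)` in mean square — the steps

Topic `Literature/NumberTheory/LFunctions`. Everything in this file is PROVED (theorems only; no
definitions, no named facts). Support file of `SelbergApproxFormulaMeanSquare.lean` (the assembly of
Selberg's mean-value approximate formula `∫_{T/2}^{T} (S(t) + π⁻¹Σ_{p≤y} sin(t log p)/√p)² dt ≪ T` from the
zero-density theorem near the critical line, Selberg 1946 §§5–6 / Titchmarsh §14.22 and §9.25), holding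
the steps that do not involve the pointwise approximate formula itself:

* §1 `msum_eq`, `fordK_eq` — the decomposition of Selberg's sums `Σ_{n<x³} Λ(n) f(log n) n^{−s₁}/log n`
  and `K_f(s₁) = Σ_{n<x³} Λ(n) f(log n) n^{−s₁}` (`s₁ = 1/2 + u + it`) into the prime polynomials
  `P_j(u, t)` of `SelbergMeanSquareEngine.lean` (`SelbergEngine.dirPoly`) and the higher prime powers;
* §2 `norm_Dnp_le`, `norm_Qnp_sub_le`, `sum_Qnp_coeff_sq_le` — the higher prime powers are `O(log x)`
  pointwise, move by `O(u log x)` with the abscissa, and have square-summable coefficients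
  (`SelbergPrimeSumEstimates.lean`);
* §3 `sum_sin_div_sqrt_eq`, `sum_coeff_sq_le` — the sine sum as a prime polynomial and the
  coefficients `(f(log p) p^{−a} − 1_{p≤y}) p^{−1/2}` at the fixed abscissa (`Σ |·|² = O(1)` by Mertens);
* §4 `integral_norm_sq_moving_sub_le`, §5 `integral_delta_sq_mul_norm_sq_le` — removal of Selberg's
  moving abscissa `u = δ(t) = σ_{x,t} − 1/2` (`SelbergSigmaXT.lean`) from the mean squares by the
  Sobolev–Markov inequality, Fubini and Cauchy–Schwarz against the fourth moments of the prime
  polynomials and the moments `∫ δ^m` (which enter as hypotheses `∫ δ⁴ ≤ Φ₄`, `∫ δ⁶ ≤ Φ₆`).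

## References

* A. Selberg, *Contributions to the theory of the Riemann zeta-function*, Arch. Math. Naturvid. 48
  (1946) no. 5, 89–155, §§5–6.
* E. C. Titchmarsh, *The Theory of the Riemann Zeta-Function*, 2nd ed. rev. D. R. Heath-Brown (1986),
  §§14.21–14.22, §9.25. [cite: Titchmarsh1986, §14.22]
-/

noncomputable section

open Real MeasureTheory Set Filter Complex intervalIntegral
open scoped ComplexConjugate

namespace Literature.NumberTheory.LFunctions

namespace SelbergMeanSquare

open SelbergEngine SelbergExplicit

/-! ### §1 The algebra of the decomposition into primes and higher prime powers -/

/-- `n^{−(σ+it)} = e^{−σ log n} · n^{−it}` for `n ≥ 1`. [folklore] -/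
theorem natCast_cpow_neg_ofReal_add {n : ℕ} (hn : n ≠ 0) (σ t : ℝ) :
    (n : ℂ) ^ (-((σ : ℂ) + t * I)) =
      ((Real.exp (-(σ * Real.log n)) : ℝ) : ℂ) * (n : ℂ) ^ (-((t : ℂ) * I)) := by
  have hn' : (n : ℂ) ≠ 0 := by exact_mod_cast hn
  rw [Complex.cpow_def_of_ne_zero hn', natCast_cpow_neg_mul_I hn, Complex.ofReal_exp, ← Complex.exp_add,
    ← Complex.natCast_log]
  congr 1
  push_cast
  ring

/-- The primes of `[2, M]` inside `Ico 2 (M+1)`. [folklore] -/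
theorem filter_prime_Ico_eq (M : ℕ) : (Finset.Ico 2 (M + 1)).filter Nat.Prime = Nat.primesLE M := by
  ext p
  simp only [Finset.mem_filter, Finset.mem_Ico, Nat.mem_primesLE]
  constructor
  · rintro ⟨⟨-, h2⟩, hp⟩; exact ⟨by omega, hp⟩
  · rintro ⟨h1, hp⟩; exact ⟨⟨hp.two_le, by omega⟩, hp⟩

/-- The general term of Selberg's sums in the `dirPoly` normal form: for `n ≥ 2`,
`Λ(n) f(log n) n^{−s₁}/log n = (Λ(n) f(log n)/log n · e^{−(1/2+u) log n}) · n^{−it}`,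
`s₁ = (1/2 + u) + it`. [folklore] -/
theorem term_eq {n : ℕ} (hn : n ≠ 0) (c : ℝ) (u t : ℝ) :
    ((c : ℝ) : ℂ) * ((n : ℂ) ^ (-((((1 / 2 + u : ℝ)) : ℂ) + t * I))) =
      (((c * Real.exp (-((1 / 2 + u) * Real.log n))) : ℝ) : ℂ) * (n : ℂ) ^ (-((t : ℂ) * I)) := by
  rw [natCast_cpow_neg_ofReal_add hn]
  push_cast
  ring

/-- **The prime / prime-power decomposition of `M(t)`.** With `s₁ = (1/2 + u) + it`,
`f = f_ℓ`, `S` the primes `≤ M` and `A` the non-primes of `[2, M]`: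
`Σ_{2 ≤ n ≤ M} Λ(n) f(log n) n^{−s₁}/log n = P₀(S, f∘log; u, t) + P₀(A, Λ f∘log / log; u, t)`.
[cite: Titchmarsh1986, §14.21] -/
theorem msum_eq (M : ℕ) (ℓ u t : ℝ) :
    ∑ n ∈ Finset.Ico 2 (M + 1),
        ((ArithmeticFunction.vonMangoldt n : ℝ) : ℂ) * (smoothing ℓ (Real.log n) : ℂ) *
          ((n : ℂ) ^ (-((((1 / 2 + u : ℝ)) : ℂ) + t * I)) / (Real.log n : ℂ)) =
      dirPoly (Nat.primesLE M) (fun n ↦ smoothing ℓ (Real.log n)) 0 u t +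
        dirPoly ((Finset.Ico 2 (M + 1)).filter (fun n ↦ ¬ n.Prime))
          (fun n ↦ ArithmeticFunction.vonMangoldt n * smoothing ℓ (Real.log n) / Real.log n) 0 u t := by
  classical
  rw [← Finset.sum_filter_add_sum_filter_not (Finset.Ico 2 (M + 1)) Nat.Prime, filter_prime_Ico_eq]
  congr 1
  · rw [dirPoly_def]
    refine Finset.sum_congr rfl fun p hp ↦ ?_
    have hpp := (Nat.mem_primesLE.1 hp).2
    have hp0 : p ≠ 0 := hpp.ne_zero
    have hlog : (Real.log p : ℂ) ≠ 0 := by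
      have : 0 < Real.log p := Real.log_pos (by exact_mod_cast hpp.one_lt)
      exact_mod_cast this.ne'
    rw [ArithmeticFunction.vonMangoldt_apply_prime hpp]
    have e1 : ((Real.log p : ℝ) : ℂ) * (smoothing ℓ (Real.log p) : ℂ) *
        ((p : ℂ) ^ (-((((1 / 2 + u : ℝ)) : ℂ) + t * I)) / (Real.log p : ℂ)) =
        (smoothing ℓ (Real.log p) : ℂ) * (p : ℂ) ^ (-((((1 / 2 + u : ℝ)) : ℂ) + t * I)) := by
      field_simp
    rw [e1, term_eq hp0]; push_cast; ring
  · rw [dirPoly_def]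
    refine Finset.sum_congr rfl fun n hn ↦ ?_
    rw [Finset.mem_filter, Finset.mem_Ico] at hn
    have hn0 : n ≠ 0 := by omega
    have e : ((ArithmeticFunction.vonMangoldt n : ℝ) : ℂ) * (smoothing ℓ (Real.log n) : ℂ) *
        ((n : ℂ) ^ (-((((1 / 2 + u : ℝ)) : ℂ) + t * I)) / (Real.log n : ℂ)) =
        (((ArithmeticFunction.vonMangoldt n * smoothing ℓ (Real.log n) / Real.log n : ℝ)) : ℂ) *
          ((n : ℂ) ^ (-((((1 / 2 + u : ℝ)) : ℂ) + t * I))) := by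
      push_cast; ring
    rw [e, term_eq hn0]; push_cast; ring

/-- **The prime / prime-power decomposition of `D(s₁) = K_{f_ℓ}(s₁)`.** With `3ℓ ≤ log (M+1)`:
`K_f(s₁) = −P₁(S, f∘log; u, t) + P₀(A, Λ·f∘log; u, t)`. [cite: Titchmarsh1986, §14.21] -/
theorem fordK_eq {M : ℕ} {ℓ : ℝ} (hℓ : 0 ≤ ℓ) (hM : 3 * ℓ ≤ Real.log (M + 1 : ℕ)) (u t : ℝ) :
    fordK (smoothing ℓ) ((((1 / 2 + u : ℝ)) : ℂ) + t * I) =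
      -dirPoly (Nat.primesLE M) (fun n ↦ smoothing ℓ (Real.log n)) 1 u t +
        dirPoly ((Finset.Ico 2 (M + 1)).filter (fun n ↦ ¬ n.Prime))
          (fun n ↦ ArithmeticFunction.vonMangoldt n * smoothing ℓ (Real.log n)) 0 u t := by
  classical
  rw [fordK_smoothing_eq_sum hℓ (by omega) hM]
  -- drop `n = 0, 1`
  have hdrop : ∑ n ∈ Finset.range (M + 1),
      ((ArithmeticFunction.vonMangoldt n : ℝ) : ℂ) * (smoothing ℓ (Real.log n) : ℂ) *
        (n : ℂ) ^ (-((((1 / 2 + u : ℝ)) : ℂ) + t * I)) =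
      ∑ n ∈ Finset.Ico 2 (M + 1),
      ((ArithmeticFunction.vonMangoldt n : ℝ) : ℂ) * (smoothing ℓ (Real.log n) : ℂ) *
        (n : ℂ) ^ (-((((1 / 2 + u : ℝ)) : ℂ) + t * I)) := by
    refine (Finset.sum_subset (fun n hn ↦ ?_) (fun n hn hn' ↦ ?_)).symm
    · rw [Finset.mem_Ico] at hn; exact Finset.mem_range.2 hn.2
    · rw [Finset.mem_range] at hn
      rw [Finset.mem_Ico, not_and_or, not_le] at hn'
      have : n = 0 ∨ n = 1 := by omega
      rcases this with rfl | rfl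
      · simp
      · simp [ArithmeticFunction.vonMangoldt_apply_one]
  rw [hdrop, ← Finset.sum_filter_add_sum_filter_not (Finset.Ico 2 (M + 1)) Nat.Prime, filter_prime_Ico_eq]
  congr 1
  · rw [dirPoly_def, ← Finset.sum_neg_distrib]
    refine Finset.sum_congr rfl fun p hp ↦ ?_
    have hpp := (Nat.mem_primesLE.1 hp).2
    rw [ArithmeticFunction.vonMangoldt_apply_prime hpp,
      show ((Real.log p : ℝ) : ℂ) * (smoothing ℓ (Real.log p) : ℂ) =
        (((Real.log p * smoothing ℓ (Real.log p) : ℝ)) : ℂ) by push_cast; ring,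
      term_eq hpp.ne_zero]
    push_cast; ring
  · rw [dirPoly_def]
    refine Finset.sum_congr rfl fun n hn ↦ ?_
    rw [Finset.mem_filter, Finset.mem_Ico] at hn
    have hn0 : n ≠ 0 := by omega
    rw [show ((ArithmeticFunction.vonMangoldt n : ℝ) : ℂ) * (smoothing ℓ (Real.log n) : ℂ) =
        (((ArithmeticFunction.vonMangoldt n * smoothing ℓ (Real.log n) : ℝ)) : ℂ) by push_cast; ring,
      term_eq hn0]
    push_cast; ring

/-! ### §2 The higher prime powers are small -/

/-- `Σ_{n ∈ A} Λ(n) n^{−1/2} ≤ 4 log(M+1) + 6` for the non-primes `A` of `[2, M]`. [folklore] -/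
theorem sum_A_vonMangoldt_rpow_le (M : ℕ) :
    ∑ n ∈ (Finset.Ico 2 (M + 1)).filter (fun n ↦ ¬ n.Prime),
        ArithmeticFunction.vonMangoldt n * (n : ℝ) ^ (-(1 / 2 : ℝ)) ≤ 4 * Real.log (M + 1 : ℕ) + 6 := by
  refine le_trans (Finset.sum_le_sum_of_subset_of_nonneg (fun n hn ↦ ?_) (fun n _ _ ↦ ?_))
    (SelbergPrimes.sum_nonprime_vonMangoldt_rpow_le (M + 1))
  · rw [Finset.mem_filter, Finset.mem_Ico] at hn
    exact Finset.mem_filter.2 ⟨Finset.mem_range.2 hn.1.2, hn.2⟩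
  · exact mul_nonneg ArithmeticFunction.vonMangoldt_nonneg (Real.rpow_nonneg (Nat.cast_nonneg n) _)

/-- **The higher prime powers in `D`**: `‖P₀(A, Λ f∘log; u, t)‖ ≤ 4 log(M+1) + 6` for `u ≥ 0`
(`0 ≤ f ≤ 1`, `e^{−(1/2+u) log n} ≤ n^{−1/2}`). [cite: Titchmarsh1986, §14.21] -/
theorem norm_Dnp_le (M : ℕ) {ℓ u : ℝ} (hℓ : 0 < ℓ) (hu : 0 ≤ u) (t : ℝ) :
    ‖dirPoly ((Finset.Ico 2 (M + 1)).filter (fun n ↦ ¬ n.Prime))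
        (fun n ↦ ArithmeticFunction.vonMangoldt n * smoothing ℓ (Real.log n)) 0 u t‖ ≤
      4 * Real.log (M + 1 : ℕ) + 6 := by
  rw [dirPoly_def]
  refine (norm_sum_le _ _).trans ((Finset.sum_le_sum fun n hn ↦ ?_).trans (sum_A_vonMangoldt_rpow_le M))
  rw [Finset.mem_filter, Finset.mem_Ico] at hn
  have hn0 : n ≠ 0 := by omega
  have hn1 : (1 : ℝ) ≤ n := by exact_mod_cast (show 1 ≤ n by omega)
  have hnpos : (0 : ℝ) < n := by linarith
  have hlog : 0 ≤ Real.log n := Real.log_nonneg hn1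
  have hf0 := smoothing_nonneg hℓ (Real.log n)
  have hf1 := smoothing_le_one hℓ (Real.log n)
  have hΛ : 0 ≤ ArithmeticFunction.vonMangoldt n := ArithmeticFunction.vonMangoldt_nonneg
  rw [norm_mul, natCast_cpow_neg_mul_I hn0, Complex.norm_exp_ofReal_mul_I, mul_one, Complex.norm_real,
    Real.norm_eq_abs, pow_zero, one_mul, abs_of_nonneg (by positivity)]
  have hexp : Real.exp (-((1 / 2 + u) * Real.log n)) ≤ (n : ℝ) ^ (-(1 / 2 : ℝ)) := by
    rw [Real.rpow_def_of_pos hnpos]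
    exact Real.exp_le_exp.2 (by nlinarith)
  calc ArithmeticFunction.vonMangoldt n * smoothing ℓ (Real.log n) * Real.exp (-((1 / 2 + u) * Real.log n))
      ≤ ArithmeticFunction.vonMangoldt n * 1 * (n : ℝ) ^ (-(1 / 2 : ℝ)) := by gcongr
    _ = ArithmeticFunction.vonMangoldt n * (n : ℝ) ^ (-(1 / 2 : ℝ)) := by ring

/-- **The higher prime powers in `M`, moving point versus `u = 0`**:
`‖P₀(A, w; u, t) − P₀(A, w; 0, t)‖ ≤ u (4 log(M+1) + 6)` for `u ≥ 0`, `w = Λ f∘log / log`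
(`|e^{−(1/2+u)L} − e^{−L/2}| = e^{−L/2}(1 − e^{−uL}) ≤ e^{−L/2} · uL`). [cite: Titchmarsh1986, §14.21] -/
theorem norm_Qnp_sub_le (M : ℕ) {ℓ u : ℝ} (hℓ : 0 < ℓ) (hu : 0 ≤ u) (t : ℝ) :
    ‖dirPoly ((Finset.Ico 2 (M + 1)).filter (fun n ↦ ¬ n.Prime))
        (fun n ↦ ArithmeticFunction.vonMangoldt n * smoothing ℓ (Real.log n) / Real.log n) 0 u t -
      dirPoly ((Finset.Ico 2 (M + 1)).filter (fun n ↦ ¬ n.Prime))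
        (fun n ↦ ArithmeticFunction.vonMangoldt n * smoothing ℓ (Real.log n) / Real.log n) 0 0 t‖ ≤
      u * (4 * Real.log (M + 1 : ℕ) + 6) := by
  rw [dirPoly_def, dirPoly_def, ← Finset.sum_sub_distrib]
  refine (norm_sum_le _ _).trans ?_
  have key : ∀ n ∈ (Finset.Ico 2 (M + 1)).filter (fun n ↦ ¬ n.Prime),
      ‖(((-Real.log n) ^ 0 * (ArithmeticFunction.vonMangoldt n * smoothing ℓ (Real.log n) / Real.log n) *
            Real.exp (-((1 / 2 + u) * Real.log n)) : ℝ) : ℂ) * (n : ℂ) ^ (-((t : ℂ) * I)) -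
        (((-Real.log n) ^ 0 * (ArithmeticFunction.vonMangoldt n * smoothing ℓ (Real.log n) / Real.log n) *
            Real.exp (-((1 / 2 + 0) * Real.log n)) : ℝ) : ℂ) * (n : ℂ) ^ (-((t : ℂ) * I))‖ ≤
        u * (ArithmeticFunction.vonMangoldt n * (n : ℝ) ^ (-(1 / 2 : ℝ))) := by
    intro n hn
    rw [Finset.mem_filter, Finset.mem_Ico] at hn
    have hn0 : n ≠ 0 := by omega
    have hn2 : (2 : ℝ) ≤ n := by exact_mod_cast hn.1.1
    have hnpos : (0 : ℝ) < n := by linarith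
    have hlog : 0 < Real.log n := Real.log_pos (by linarith)
    have hf0 := smoothing_nonneg hℓ (Real.log n)
    have hf1 := smoothing_le_one hℓ (Real.log n)
    have hΛ : 0 ≤ ArithmeticFunction.vonMangoldt n := ArithmeticFunction.vonMangoldt_nonneg
    have hΛle : ArithmeticFunction.vonMangoldt n ≤ Real.log n := ArithmeticFunction.vonMangoldt_le_log
    rw [← sub_mul, norm_mul, natCast_cpow_neg_mul_I hn0, Complex.norm_exp_ofReal_mul_I, mul_one,
      ← Complex.ofReal_sub, Complex.norm_real, Real.norm_eq_abs, pow_zero, one_mul, add_zero,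
      ← mul_sub]
    have hlog' : Real.log n ≠ 0 := hlog.ne'
    -- `|e^{-(1/2+u)L} - e^{-L/2}| = e^{-L/2} (1 - e^{-uL}) ≤ e^{-L/2} u L`
    have hsplit : Real.exp (-((1 / 2 + u) * Real.log n)) - Real.exp (-(1 / 2 * Real.log n)) =
        -(Real.exp (-(1 / 2 * Real.log n)) * (1 - Real.exp (-(u * Real.log n)))) := by
      rw [mul_sub, mul_one, ← Real.exp_add]
      ring_nf
    have h1e : 0 ≤ 1 - Real.exp (-(u * Real.log n)) := by
      rw [sub_nonneg, Real.exp_le_one_iff]; nlinarith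
    have h1e' : 1 - Real.exp (-(u * Real.log n)) ≤ u * Real.log n := by
      have := Real.add_one_le_exp (-(u * Real.log n)); linarith
    have hhalf : Real.exp (-(1 / 2 * Real.log n)) = (n : ℝ) ^ (-(1 / 2 : ℝ)) := by
      rw [Real.rpow_def_of_pos hnpos]; congr 1; ring
    rw [hsplit, abs_mul, abs_neg, abs_mul, abs_of_nonneg (Real.exp_pos _).le, abs_of_nonneg h1e,
      abs_of_nonneg (div_nonneg (mul_nonneg hΛ hf0) hlog.le), hhalf]
    calc ArithmeticFunction.vonMangoldt n * smoothing ℓ (Real.log n) / Real.log n *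
          ((n : ℝ) ^ (-(1 / 2 : ℝ)) * (1 - Real.exp (-(u * Real.log n))))
        ≤ ArithmeticFunction.vonMangoldt n * 1 / Real.log n * ((n : ℝ) ^ (-(1 / 2 : ℝ)) * (u * Real.log n)) := by
          gcongr
      _ = u * (ArithmeticFunction.vonMangoldt n * (n : ℝ) ^ (-(1 / 2 : ℝ))) := by
          field_simp
  refine (Finset.sum_le_sum key).trans ?_
  rw [← Finset.mul_sum]
  exact mul_le_mul_of_nonneg_left (sum_A_vonMangoldt_rpow_le M) hu

/-- **The higher prime powers in `M` at `u = 0` have square-summable coefficients**: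
`Σ_{n ∈ A} (Λ(n) f(log n)/log n)² n^{−1} ≤ 4` (`Λ(n)/log n ≤ 1`, `0 ≤ f ≤ 1`, and
`Σ_{n ∈ A, Λ(n) ≠ 0} 1/n ≤ 4`). [folklore] -/
theorem sum_Qnp_coeff_sq_le (M : ℕ) {ℓ : ℝ} (hℓ : 0 < ℓ) :
    ∑ n ∈ (Finset.Ico 2 (M + 1)).filter (fun n ↦ ¬ n.Prime),
        Real.log n ^ (2 * 0) *
          (ArithmeticFunction.vonMangoldt n * smoothing ℓ (Real.log n) / Real.log n) ^ 2 *
            (n : ℝ) ^ (-(1 + 2 * (0 : ℝ))) ≤ 4 := by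
  classical
  set A := (Finset.Ico 2 (M + 1)).filter (fun n ↦ ¬ n.Prime) with hA
  have hsub : A.filter (fun n ↦ IsPrimePow n) ⊆
      ((Finset.range (M + 1)).filter (fun n ↦ ¬ n.Prime)).filter (fun n ↦ IsPrimePow n) := by
    intro n hn
    rw [Finset.mem_filter, hA, Finset.mem_filter, Finset.mem_Ico] at hn
    exact Finset.mem_filter.2 ⟨Finset.mem_filter.2 ⟨Finset.mem_range.2 hn.1.1.2, hn.1.2⟩, hn.2⟩
  -- restrict to prime powers
  have hrestrict : ∑ n ∈ A, Real.log n ^ (2 * 0) *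
        (ArithmeticFunction.vonMangoldt n * smoothing ℓ (Real.log n) / Real.log n) ^ 2 *
          (n : ℝ) ^ (-(1 + 2 * (0 : ℝ))) =
      ∑ n ∈ A.filter (fun n ↦ IsPrimePow n), Real.log n ^ (2 * 0) *
        (ArithmeticFunction.vonMangoldt n * smoothing ℓ (Real.log n) / Real.log n) ^ 2 *
          (n : ℝ) ^ (-(1 + 2 * (0 : ℝ))) := by
    refine (Finset.sum_filter_of_ne fun n _ hne ↦ ?_).symm
    by_contra h
    apply hne
    rw [ArithmeticFunction.vonMangoldt_apply]
    simp [h]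
  rw [hrestrict]
  refine le_trans (Finset.sum_le_sum fun n hn ↦ ?_)
    ((Finset.sum_le_sum_of_subset_of_nonneg hsub (fun n _ _ ↦ inv_nonneg.2 (Nat.cast_nonneg n))).trans
      (SelbergPrimes.sum_nonprime_primePow_inv_le (M + 1)))
  rw [Finset.mem_filter, hA, Finset.mem_filter, Finset.mem_Ico] at hn
  have hn2 : (2 : ℝ) ≤ n := by exact_mod_cast hn.1.1.1
  have hnpos : (0 : ℝ) < n := by linarith
  have hlog : 0 < Real.log n := Real.log_pos (by linarith)
  have hf0 := smoothing_nonneg hℓ (Real.log n)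
  have hf1 := smoothing_le_one hℓ (Real.log n)
  have hΛ : 0 ≤ ArithmeticFunction.vonMangoldt n := ArithmeticFunction.vonMangoldt_nonneg
  have hΛle : ArithmeticFunction.vonMangoldt n ≤ Real.log n := ArithmeticFunction.vonMangoldt_le_log
  have hq1 : ArithmeticFunction.vonMangoldt n * smoothing ℓ (Real.log n) / Real.log n ≤ 1 := by
    rw [div_le_one hlog]
    calc ArithmeticFunction.vonMangoldt n * smoothing ℓ (Real.log n) ≤ Real.log n * 1 := by gcongr
      _ = Real.log n := mul_one _
  have hq0 : 0 ≤ ArithmeticFunction.vonMangoldt n * smoothing ℓ (Real.log n) / Real.log n := by positivity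
  rw [mul_zero, pow_zero, one_mul, mul_zero, add_zero, Real.rpow_neg_one]
  calc (ArithmeticFunction.vonMangoldt n * smoothing ℓ (Real.log n) / Real.log n) ^ 2 * (n : ℝ)⁻¹
      ≤ 1 * (n : ℝ)⁻¹ := mul_le_mul_of_nonneg_right (by nlinarith) (inv_nonneg.2 hnpos.le)
    _ = (n : ℝ)⁻¹ := one_mul _

/-! ### §3 The sine sum and the coefficients at the fixed point `u = 4/ℓ` -/

/-- **The sine sum as a prime polynomial**: for `K ≤ M`,
`Σ_{p ≤ K} sin(t log p)/√p = −Im P₀(primes ≤ M, 1_{≤ K}; 0, t)`. [folklore] -/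
theorem sum_sin_div_sqrt_eq {M K : ℕ} (hKM : K ≤ M) (t : ℝ) :
    ∑ p ∈ Nat.primesLE K, Real.sin (t * Real.log p) / Real.sqrt p =
      -(dirPoly (Nat.primesLE M) (fun n ↦ if n ≤ K then 1 else 0) 0 0 t).im := by
  classical
  rw [dirPoly_def, Complex.im_sum, ← Finset.sum_neg_distrib]
  -- the terms with `p > K` vanish; the others are `-sin(t log p)/√p`
  have hset : Nat.primesLE K = (Nat.primesLE M).filter (fun p ↦ p ≤ K) := by
    ext p; simp only [Nat.mem_primesLE, Finset.mem_filter]; constructor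
    · rintro ⟨h1, h2⟩; exact ⟨⟨h1.trans hKM, h2⟩, h1⟩
    · rintro ⟨⟨-, h2⟩, h1⟩; exact ⟨h1, h2⟩
  rw [hset, Finset.sum_filter]
  refine Finset.sum_congr rfl fun p hp ↦ ?_
  have hp0 : p ≠ 0 := (Nat.mem_primesLE.1 hp).2.ne_zero
  have hppos : (0 : ℝ) < p := by exact_mod_cast Nat.pos_of_ne_zero hp0
  split_ifs with h
  · rw [natCast_cpow_neg_mul_I hp0, pow_zero, one_mul, one_mul, add_zero, Complex.im_ofReal_mul,
      Complex.exp_ofReal_mul_I_im, Real.sin_neg]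
    have : Real.exp (-(1 / 2 * Real.log p)) = (Real.sqrt p)⁻¹ := by
      rw [Real.sqrt_eq_rpow, Real.rpow_def_of_pos hppos, ← Real.exp_neg]; congr 1; ring
    rw [this]; ring
  · simp

/-- **The coefficients at the fixed point.** For weights `0 ≤ w ≤ 1` with `w(p) = 1` for `p ≤ K = ⌊y⌋`,
`2 ≤ y ≤ M`, `a ≥ 0`:
`Σ_{p ≤ M} (w(p) e^{−a log p} − 1_{p ≤ K})² / p ≤ a² log y (log y + 2) + (log log M − log log y + 16/log y)`
(for `p ≤ y`: `(1 − e^{−a log p})² ≤ a² log² p` and Mertens I; for `p > y`: `≤ 1/p` and Mertens II).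
[cite: HardyWright2008, Thm 425 (§22.6)] -/
theorem sum_coeff_sq_le {M : ℕ} {y a : ℝ} (w : ℕ → ℝ) (hw0 : ∀ p, 0 ≤ w p) (hw1 : ∀ p, w p ≤ 1)
    (hwy : ∀ p ∈ Nat.primesLE ⌊y⌋₊, w p = 1) (hy : 2 ≤ y) (hyM : y ≤ M) (ha : 0 ≤ a) :
    ∑ p ∈ Nat.primesLE M, (w p * Real.exp (-(a * Real.log p)) - if p ≤ ⌊y⌋₊ then 1 else 0) ^ 2 * (p : ℝ)⁻¹ ≤
      a ^ 2 * (Real.log y * (Real.log y + 2)) +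
        (Real.log (Real.log M) - Real.log (Real.log y) + 16 / Real.log y) := by
  classical
  have hy0 : 0 ≤ y := by linarith
  rw [← Finset.sum_filter_add_sum_filter_not (Nat.primesLE M) (fun p ↦ p ≤ ⌊y⌋₊)]
  refine add_le_add ?_ ?_
  · -- `p ≤ ⌊y⌋`
    have hset : (Nat.primesLE M).filter (fun p ↦ p ≤ ⌊y⌋₊) = Nat.primesLE ⌊y⌋₊ := by
      ext p; simp only [Nat.mem_primesLE, Finset.mem_filter]; constructor
      · rintro ⟨⟨-, h2⟩, h1⟩; exact ⟨h1, h2⟩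
      · rintro ⟨h1, h2⟩
        refine ⟨⟨?_, h2⟩, h1⟩
        have : (p : ℝ) ≤ M := ((Nat.le_floor_iff hy0).1 h1).trans hyM
        exact_mod_cast this
    rw [hset]
    calc ∑ p ∈ Nat.primesLE ⌊y⌋₊, (w p * Real.exp (-(a * Real.log p)) - if p ≤ ⌊y⌋₊ then 1 else 0) ^ 2 * (p : ℝ)⁻¹
        ≤ ∑ p ∈ Nat.primesLE ⌊y⌋₊, a ^ 2 * (Real.log p ^ 2 / p) := by
          refine Finset.sum_le_sum fun p hp ↦ ?_
          have hpK := (Nat.mem_primesLE.1 hp).1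
          have hpp := (Nat.mem_primesLE.1 hp).2
          have hp1 : (1 : ℝ) ≤ p := by exact_mod_cast hpp.one_lt.le
          have hlog : 0 ≤ Real.log p := Real.log_nonneg hp1
          rw [if_pos hpK, hwy p hp, one_mul]
          have hx : 0 ≤ a * Real.log p := mul_nonneg ha hlog
          have h1 : 0 ≤ 1 - Real.exp (-(a * Real.log p)) := by
            rw [sub_nonneg, Real.exp_le_one_iff]; linarith
          have h2 : 1 - Real.exp (-(a * Real.log p)) ≤ a * Real.log p := by
            have := Real.add_one_le_exp (-(a * Real.log p)); linarith
          have h3 : (Real.exp (-(a * Real.log p)) - 1) ^ 2 ≤ (a * Real.log p) ^ 2 := by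
            rw [show Real.exp (-(a * Real.log p)) - 1 = -(1 - Real.exp (-(a * Real.log p))) by ring, neg_sq]
            exact pow_le_pow_left₀ h1 h2 2
          rw [div_eq_mul_inv, ← mul_assoc]
          refine mul_le_mul_of_nonneg_right ?_ (inv_nonneg.2 (by linarith))
          calc (Real.exp (-(a * Real.log p)) - 1) ^ 2 ≤ (a * Real.log p) ^ 2 := h3
            _ = a ^ 2 * Real.log p ^ 2 := by ring
      _ = a ^ 2 * ∑ p ∈ Nat.primesLE ⌊y⌋₊, Real.log p ^ 2 / p := by rw [Finset.mul_sum]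
      _ ≤ a ^ 2 * (Real.log y * (Real.log y + 2)) :=
          mul_le_mul_of_nonneg_left (SelbergPrimes.sum_log_sq_div_le (by linarith)) (sq_nonneg a)
  · -- `p > ⌊y⌋`, i.e. `y < p`
    have hset : (Nat.primesLE M).filter (fun p ↦ ¬ p ≤ ⌊y⌋₊) =
        (Nat.primesLE ⌊(M : ℝ)⌋₊).filter (fun p : ℕ ↦ y < (p : ℝ)) := by
      rw [Nat.floor_natCast]
      refine Finset.filter_congr fun p _ ↦ ?_
      rw [not_le, Nat.floor_lt hy0]
    rw [hset]
    calc ∑ p ∈ (Nat.primesLE ⌊(M : ℝ)⌋₊).filter (fun p : ℕ ↦ y < (p : ℝ)),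
          (w p * Real.exp (-(a * Real.log p)) - if p ≤ ⌊y⌋₊ then 1 else 0) ^ 2 * (p : ℝ)⁻¹
        ≤ ∑ p ∈ (Nat.primesLE ⌊(M : ℝ)⌋₊).filter (fun p : ℕ ↦ y < (p : ℝ)), (p : ℝ)⁻¹ := by
          refine Finset.sum_le_sum fun p hp ↦ ?_
          rw [Finset.mem_filter, Nat.mem_primesLE] at hp
          have hpp := hp.1.2
          have hp1 : (1 : ℝ) ≤ p := by exact_mod_cast hpp.one_lt.le
          have hlog : 0 ≤ Real.log p := Real.log_nonneg hp1
          have hnot : ¬ p ≤ ⌊y⌋₊ := by rw [not_le, Nat.floor_lt hy0]; exact hp.2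
          rw [if_neg hnot, sub_zero]
          have he : Real.exp (-(a * Real.log p)) ≤ 1 := by
            rw [Real.exp_le_one_iff]; nlinarith
          have h0 : 0 ≤ w p * Real.exp (-(a * Real.log p)) := mul_nonneg (hw0 p) (Real.exp_pos _).le
          have h1 : w p * Real.exp (-(a * Real.log p)) ≤ 1 := by
            calc w p * Real.exp (-(a * Real.log p)) ≤ 1 * 1 :=
                  mul_le_mul (hw1 p) he (Real.exp_pos _).le zero_le_one
              _ = 1 := mul_one _
          have hp0 : (0 : ℝ) ≤ (p : ℝ)⁻¹ := inv_nonneg.2 (by linarith)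
          calc (w p * Real.exp (-(a * Real.log p))) ^ 2 * (p : ℝ)⁻¹ ≤ 1 * (p : ℝ)⁻¹ :=
                mul_le_mul_of_nonneg_right (by nlinarith) hp0
            _ = (p : ℝ)⁻¹ := one_mul _
      _ ≤ Real.log (Real.log M) - Real.log (Real.log y) + 16 / Real.log y :=
          SelbergPrimes.sum_inv_primes_window_le hy hyM

/-! ### §4 Removing the moving abscissa: the prime part of `M` -/

/-- Continuity of `t ↦ P_j(S, w; u, t)` for fixed `u` (`0 ∉ S`). [folklore] -/
theorem continuous_dirPoly_right {S : Finset ℕ} (hS : ∀ n ∈ S, n ≠ 0) (w : ℕ → ℝ) (j : ℕ) (u : ℝ) :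
    Continuous fun t : ℝ ↦ dirPoly S w j u t := by
  simp only [dirPoly_def]
  refine continuous_finsetSum _ fun n hn ↦ ?_
  simp_rw [natCast_cpow_neg_mul_I (hS n hn)]
  fun_prop

/-- Continuity of `u ↦ P_j(S, w; u, t)` for fixed `t`. [folklore] -/
theorem continuous_dirPoly_left (S : Finset ℕ) (w : ℕ → ℝ) (j : ℕ) (t : ℝ) :
    Continuous fun u : ℝ ↦ dirPoly S w j u t := by
  simp only [dirPoly_def]
  refine continuous_finsetSum _ fun n _ ↦ ?_
  exact (Complex.continuous_ofReal.comp (by fun_prop)).mul continuous_const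


/-- `√(c · 2x²) = √(2c) · x` for `x, c ≥ 0`. [folklore] -/
theorem sqrt_mul_two_mul_sq {c x : ℝ} (hc : 0 ≤ c) (hx : 0 ≤ x) :
    Real.sqrt (c * (2 * x ^ 2)) = Real.sqrt (2 * c) * x := by
  rw [show c * (2 * x ^ 2) = (2 * c) * x ^ 2 by ring, Real.sqrt_mul (by positivity), Real.sqrt_sq hx]

/-- `∫_a^1 u^{−3} du ≤ 1/(2a²)` for `0 < a ≤ 1` (primitive `−u^{−2}/2`). [folklore] -/
theorem integral_inv_pow_three_le {a : ℝ} (ha : 0 < a) (ha1 : a ≤ 1) :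
    ∫ u in a..1, (u ^ 3)⁻¹ ≤ 1 / (2 * a ^ 2) := by
  have hderiv : ∀ u ∈ Set.uIcc a 1, HasDerivAt (fun u : ℝ ↦ -(1 / 2) * (u ^ 2)⁻¹) ((u ^ 3)⁻¹) u := by
    intro u hu
    rw [Set.uIcc_of_le ha1] at hu
    have hu0 : u ≠ 0 := (ha.trans_le hu.1).ne'
    have h1 : HasDerivAt (fun u : ℝ ↦ u ^ 2) (2 * u) u := by simpa using hasDerivAt_pow 2 u
    have h2 := (h1.inv (pow_ne_zero 2 hu0)).const_mul (-(1 / 2) : ℝ)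
    refine h2.congr_deriv ?_
    field_simp
  have hcont : ContinuousOn (fun u : ℝ ↦ (u ^ 3)⁻¹) (Set.uIcc a 1) := by
    rw [Set.uIcc_of_le ha1]
    refine ContinuousOn.inv₀ (continuousOn_pow 3) fun u hu ↦ pow_ne_zero 3 (ha.trans_le hu.1).ne'
  rw [integral_eq_sub_of_hasDerivAt hderiv (hcont.intervalIntegrable)]
  have ha2 : 0 < a ^ 2 := by positivity
  rw [one_pow, inv_one, div_eq_mul_inv, one_mul, one_div, mul_inv]
  nlinarith [inv_nonneg.2 ha2.le]

/-- `∫_a^1 u^{−4} du ≤ 1/(3a³)` for `0 < a ≤ 1` (primitive `−u^{−3}/3`). [folklore] -/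
theorem integral_inv_pow_four_le {a : ℝ} (ha : 0 < a) (ha1 : a ≤ 1) :
    ∫ u in a..1, (u ^ 4)⁻¹ ≤ 1 / (3 * a ^ 3) := by
  have hderiv : ∀ u ∈ Set.uIcc a 1, HasDerivAt (fun u : ℝ ↦ -(1 / 3) * (u ^ 3)⁻¹) ((u ^ 4)⁻¹) u := by
    intro u hu
    rw [Set.uIcc_of_le ha1] at hu
    have hu0 : u ≠ 0 := (ha.trans_le hu.1).ne'
    have h1 : HasDerivAt (fun u : ℝ ↦ u ^ 3) (3 * u ^ 2) u := by simpa using hasDerivAt_pow 3 u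
    have h2 := (h1.inv (pow_ne_zero 3 hu0)).const_mul (-(1 / 3) : ℝ)
    refine h2.congr_deriv ?_
    field_simp
  have hcont : ContinuousOn (fun u : ℝ ↦ (u ^ 4)⁻¹) (Set.uIcc a 1) := by
    rw [Set.uIcc_of_le ha1]
    refine ContinuousOn.inv₀ (continuousOn_pow 4) fun u hu ↦ pow_ne_zero 4 (ha.trans_le hu.1).ne'
  rw [integral_eq_sub_of_hasDerivAt hderiv (hcont.intervalIntegrable)]
  have ha3 : 0 < a ^ 3 := by positivity
  rw [one_pow, inv_one, div_eq_mul_inv, one_mul, one_div, mul_inv]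
  nlinarith [inv_nonneg.2 ha3.le]

/-- The coefficient sums of the prime polynomials with `|w| ≤ 1` against the block lemma:
`Σ_p log^{2j} p · w(p)² p^{−1−2u} ≤ Σ_p log^{2j} p · p^{−1−2u}`. [folklore] -/
theorem sum_coeff_le_of_abs_le_one {N : ℕ} {w : ℕ → ℝ} (hw : ∀ p, |w p| ≤ 1) (j : ℕ) (u : ℝ) :
    ∑ p ∈ Nat.primesLE N, Real.log p ^ (2 * j) * w p ^ 2 * (p : ℝ) ^ (-(1 + 2 * u)) ≤
      ∑ p ∈ Nat.primesLE N, Real.log p ^ (2 * j) * (p : ℝ) ^ (-(1 + 2 * u)) := by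
  refine Finset.sum_le_sum fun p hp ↦ ?_
  have hl : 0 ≤ Real.log p := Real.log_natCast_nonneg p
  have hr : 0 ≤ (p : ℝ) ^ (-(1 + 2 * u)) := Real.rpow_nonneg (Nat.cast_nonneg p) _
  have hw2 : w p ^ 2 ≤ 1 := by
    have := hw p; rw [abs_le] at this; nlinarith
  calc Real.log p ^ (2 * j) * w p ^ 2 * (p : ℝ) ^ (-(1 + 2 * u))
      ≤ Real.log p ^ (2 * j) * 1 * (p : ℝ) ^ (-(1 + 2 * u)) := by gcongr
    _ = Real.log p ^ (2 * j) * (p : ℝ) ^ (-(1 + 2 * u)) := by ring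

/-- The fourth moment of `P₁` and of `P₂` on `[T/2, T]` for `|w| ≤ 1`, `0 < u ≤ 1`, in closed form:
`∫ ‖P₁(u,·)‖⁴ ≤ T″ · 2 (60/u²)²`, `∫ ‖P₂(u,·)‖⁴ ≤ T″ · 2 (360/u⁴)²`, `T″ = T/2 + 8N²(1 + log N²)`.
[cite: Titchmarsh1986, §14.22] -/
theorem integral_norm_P1_pow_four_le {N : ℕ} {w : ℕ → ℝ} (hw : ∀ p, |w p| ≤ 1) {u T : ℝ} (hu : 0 < u)
    (hu1 : u ≤ 1) (hT : 0 ≤ T) :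
    ∫ t in T / 2..T, ‖dirPoly (Nat.primesLE N) w 1 u t‖ ^ 4 ≤
      (T / 2 + 8 * (N : ℝ) ^ 2 * (1 + Real.log ((N : ℝ) ^ 2))) * (2 * (60 / u ^ 2) ^ 2) := by
  have h1 := integral_norm_dirPoly_pow_four_le N w 1 u hT
  have h2 := (sum_coeff_le_of_abs_le_one hw 1 u).trans (SelbergPrimes.sum_log_sq_mul_rpow_le hu hu1 N)
  have h0 : 0 ≤ ∑ p ∈ Nat.primesLE N, Real.log p ^ (2 * 1) * w p ^ 2 * (p : ℝ) ^ (-(1 + 2 * u)) :=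
    Finset.sum_nonneg fun p _ ↦ mul_nonneg (mul_nonneg (pow_nonneg (Real.log_natCast_nonneg p) _)
      (sq_nonneg _)) (Real.rpow_nonneg (Nat.cast_nonneg p) _)
  have hT'' : 0 ≤ T / 2 + 8 * (N : ℝ) ^ 2 * (1 + Real.log ((N : ℝ) ^ 2)) := by
    have : 0 ≤ Real.log ((N : ℝ) ^ 2) := by
      rw [← Nat.cast_pow]; exact Real.log_natCast_nonneg _
    positivity
  refine h1.trans (mul_le_mul_of_nonneg_left ?_ hT'')
  simp only [show 2 * 1 = 2 from rfl] at h2 h0 ⊢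
  nlinarith [pow_le_pow_left₀ h0 h2 2]

/-- `∫ ‖P₂(u,·)‖⁴ ≤ T″ · 2 (360/u⁴)²` (see `integral_norm_P1_pow_four_le`). [cite: Titchmarsh1986, §14.22] -/
theorem integral_norm_P2_pow_four_le {N : ℕ} {w : ℕ → ℝ} (hw : ∀ p, |w p| ≤ 1) {u T : ℝ} (hu : 0 < u)
    (hu1 : u ≤ 1) (hT : 0 ≤ T) :
    ∫ t in T / 2..T, ‖dirPoly (Nat.primesLE N) w 2 u t‖ ^ 4 ≤
      (T / 2 + 8 * (N : ℝ) ^ 2 * (1 + Real.log ((N : ℝ) ^ 2))) * (2 * (360 / u ^ 4) ^ 2) := by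
  have h1 := integral_norm_dirPoly_pow_four_le N w 2 u hT
  have h2 := (sum_coeff_le_of_abs_le_one hw 2 u).trans (SelbergPrimes.sum_log_pow_four_mul_rpow_le hu hu1 N)
  have h0 : 0 ≤ ∑ p ∈ Nat.primesLE N, Real.log p ^ (2 * 2) * w p ^ 2 * (p : ℝ) ^ (-(1 + 2 * u)) :=
    Finset.sum_nonneg fun p _ ↦ mul_nonneg (mul_nonneg (pow_nonneg (Real.log_natCast_nonneg p) _)
      (sq_nonneg _)) (Real.rpow_nonneg (Nat.cast_nonneg p) _)
  have hT'' : 0 ≤ T / 2 + 8 * (N : ℝ) ^ 2 * (1 + Real.log ((N : ℝ) ^ 2)) := by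
    have : 0 ≤ Real.log ((N : ℝ) ^ 2) := by
      rw [← Nat.cast_pow]; exact Real.log_natCast_nonneg _
    positivity
  refine h1.trans (mul_le_mul_of_nonneg_left ?_ hT'')
  simp only [show 2 * 2 = 4 from rfl] at h2 h0 ⊢
  nlinarith [pow_le_pow_left₀ h0 h2 2]

set_option maxHeartbeats 4000000 in
/-- **Removing the moving abscissa, I (the prime part of `M`).** Let `|w| ≤ 1`, `E` a fixed prime
polynomial (`E(t) = P₀(S, w₂; 0, t)`), `ℓ > 4`, `T ≥ 0`, `8N²(1 + log N²) ≤ T/2`, `δ(t) = δ_ℓ(t)` Selberg's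
moving abscissa (`4/ℓ ≤ δ < 1`) and `∫_{T/2}^{T} δ⁴ ≤ Φ₄`. Then
`∫_{T/2}^{T} ‖P₀(w; δ(t), t) − E(t)‖² dt ≤ 2 ∫_{T/2}^{T} ‖P₀(w; 4/ℓ, t) − E(t)‖² dt + 8 √Φ₄ √T ℓ²`:
pointwise Sobolev–Markov (`m = 1`, `a = 4/ℓ`) gives
`‖P₀(δ) − E‖² ≤ 2‖P₀(a) − E‖² + 2 δ² ∫_a^1 u⁻¹ ‖P₁(u, t)‖² du`, and Fubini–Cauchy–Schwarz with the fourth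
moments `∫ δ⁴ ≤ Φ₄`, `∫‖P₁(u,·)‖⁴ ≤ 2T (60/u²)²` bounds the `t`-integral of the last term by
`√Φ₄ · 60 √(2T) ∫_a^1 u^{−3} du ≤ 4 √Φ₄ √T ℓ²`. [cite: Titchmarsh1986, §14.22] -/
theorem integral_norm_sq_moving_sub_le {N : ℕ} (w w₂ : ℕ → ℝ) (hw : ∀ p, |w p| ≤ 1) {ℓ T Φ₄ : ℝ}
    (hℓ : 4 < ℓ) (hT : 0 ≤ T) (hsize : 8 * (N : ℝ) ^ 2 * (1 + Real.log ((N : ℝ) ^ 2)) ≤ T / 2)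
    (h4 : ∫ t in T / 2..T, SelbergSigma.delta ℓ t ^ 4 ≤ Φ₄) :
    ∫ t in T / 2..T, ‖dirPoly (Nat.primesLE N) w 0 (SelbergSigma.delta ℓ t) t -
        dirPoly (Nat.primesLE N) w₂ 0 0 t‖ ^ 2 ≤
      2 * (∫ t in T / 2..T, ‖dirPoly (Nat.primesLE N) w 0 (4 / ℓ) t - dirPoly (Nat.primesLE N) w₂ 0 0 t‖ ^ 2) +
        8 * Real.sqrt Φ₄ * Real.sqrt T * ℓ ^ 2 := by
  have hS0 : ∀ n ∈ Nat.primesLE N, n ≠ 0 := fun n hn ↦ (Nat.mem_primesLE.1 hn).2.ne_zero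
  set a : ℝ := 4 / ℓ with ha
  have hℓ0 : 0 < ℓ := by linarith
  have ha0 : 0 < a := by positivity
  have ha1 : a ≤ 1 := by rw [ha, div_le_one hℓ0]; linarith
  have hδa : ∀ t, a ≤ SelbergSigma.delta ℓ t := fun t ↦ SelbergSigma.four_div_le_delta ℓ t
  have hδ1 : ∀ t, SelbergSigma.delta ℓ t ≤ 1 := fun t ↦ (SelbergSigma.delta_lt_one hℓ t).le
  have hδ0 : ∀ t, 0 ≤ SelbergSigma.delta ℓ t := fun t ↦ ha0.le.trans (hδa t)
  have hδm : Measurable fun t ↦ SelbergSigma.delta ℓ t := SelbergSigma.measurable_delta ℓ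
  have hTT : T / 2 ≤ T := by linarith
  -- the auxiliary functions `ψ(u) = 1/max(u, a)`, `H(u, t) = ‖P₁(u, t)‖²`, `g(t) = ∫_a^1 ψ H`
  obtain ⟨ψ, hψ⟩ : ∃ ψ : ℝ → ℝ, ψ = fun u ↦ (max u a)⁻¹ := ⟨_, rfl⟩
  obtain ⟨H, hH⟩ : ∃ H : ℝ → ℝ → ℝ, H = fun u t ↦ ‖dirPoly (Nat.primesLE N) w 1 u t‖ ^ 2 := ⟨_, rfl⟩
  obtain ⟨g, hg⟩ : ∃ g : ℝ → ℝ, g = fun t ↦ ∫ u in a..1, ψ u * H u t := ⟨_, rfl⟩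
  have hEc : Continuous fun t : ℝ ↦ dirPoly (Nat.primesLE N) w₂ 0 0 t := continuous_dirPoly_right hS0 w₂ 0 0
  have hψc : Continuous ψ := by
    rw [hψ]
    refine Continuous.inv₀ (continuous_id.max continuous_const) fun u ↦ ?_
    exact (lt_of_lt_of_le ha0 (le_max_right u a)).ne'
  have hψm : Measurable ψ := hψc.measurable
  have hψ0 : ∀ u, 0 ≤ ψ u := fun u ↦ by
    rw [hψ]; exact inv_nonneg.2 (ha0.le.trans (le_max_right u a))
  have hψB : ∀ u, ψ u ≤ a⁻¹ := fun u ↦ by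
    rw [hψ]; exact inv_anti₀ ha0 (le_max_right u a)
  have hψ_eq : ∀ u ∈ Icc a 1, ψ u = u⁻¹ := fun u hu ↦ by
    rw [hψ]; dsimp only; rw [max_eq_left hu.1]
  have hHc : Continuous (Function.uncurry H) := by
    rw [hH]; exact ((continuous_dirPoly hS0 w 1).norm).pow 2
  have hH0 : ∀ u t, 0 ≤ H u t := fun u t ↦ by rw [hH]; positivity
  have hH_eq : ∀ u t, H u t = ‖dirPoly (Nat.primesLE N) w 1 u t‖ ^ 2 := fun u t ↦ by rw [hH]
  have hgc : Continuous g := by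
    have : Continuous (Function.uncurry fun t u ↦ ψ u * H u t) :=
      (hψc.comp continuous_snd).mul (hHc.comp (continuous_snd.prodMk continuous_fst))
    rw [hg]
    exact intervalIntegral.continuous_parametric_intervalIntegral_of_continuous' this a 1
  have hg_eq : ∀ t, g t = ∫ u in a..1, ψ u * H u t := fun t ↦ by rw [hg]
  -- Step 1: pointwise Sobolev–Markov
  have hSM : ∀ t, ‖dirPoly (Nat.primesLE N) w 0 (SelbergSigma.delta ℓ t) t - dirPoly (Nat.primesLE N) w₂ 0 0 t‖ ^ 2 ≤
      2 * ‖dirPoly (Nat.primesLE N) w 0 a t - dirPoly (Nat.primesLE N) w₂ 0 0 t‖ ^ 2 +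
        2 * (SelbergSigma.delta ℓ t ^ 2 * g t) := by
    intro t
    have h := norm_sq_le_sobolev_markov
      (Q := fun u ↦ dirPoly (Nat.primesLE N) w 0 u t - dirPoly (Nat.primesLE N) w₂ 0 0 t)
      (Q' := fun u ↦ dirPoly (Nat.primesLE N) w 1 u t) ha0 (hδa t) (hδ1 t)
      (fun u _ ↦ (hasDerivAt_dirPoly (Nat.primesLE N) w 0 u t).sub_const _)
      (continuous_dirPoly_left (Nat.primesLE N) w 1 t).continuousOn 1
    have e : ∫ u in a..1, SelbergSigma.delta ℓ t ^ (1 + 1) / u ^ 1 * ‖dirPoly (Nat.primesLE N) w 1 u t‖ ^ 2 =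
        SelbergSigma.delta ℓ t ^ 2 * g t := by
      rw [hg_eq t, ← intervalIntegral.integral_const_mul]
      refine intervalIntegral.integral_congr fun u hu ↦ ?_
      rw [uIcc_of_le ha1] at hu
      rw [hψ_eq u hu, hH_eq, pow_one]; ring
    rw [e] at h
    exact h
  -- Step 2: integrate over `t ∈ [T/2, T]`
  obtain ⟨Bg, hBg⟩ := (isCompact_Icc (a := T / 2) (b := T)).exists_bound_of_continuousOn hgc.continuousOn
  set BQ := (∑ p ∈ Nat.primesLE N, Real.log p ^ 0 * |w p|) + ∑ p ∈ Nat.primesLE N, Real.log p ^ 0 * |w₂ p|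
    with hBQdef
  have hBQ : ∀ u t, 0 ≤ u → ‖dirPoly (Nat.primesLE N) w 0 u t - dirPoly (Nat.primesLE N) w₂ 0 0 t‖ ≤ BQ := by
    intro u t hu
    exact (norm_sub_le _ _).trans (add_le_add (norm_dirPoly_le hS0 w 0 (by linarith) t)
      (norm_dirPoly_le hS0 w₂ 0 (by norm_num) t))
  have hI_lhs : IntervalIntegrable (fun t ↦ ‖dirPoly (Nat.primesLE N) w 0 (SelbergSigma.delta ℓ t) t -
      dirPoly (Nat.primesLE N) w₂ 0 0 t‖ ^ 2) volume (T / 2) T := by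
    refine intervalIntegrable_of_bounded ?_ hTT (M := BQ ^ 2) fun t _ ↦ ?_
    · exact ((measurable_dirPoly_comp hS0 w 0 hδm).sub hEc.measurable).norm.pow_const 2
    · rw [Real.norm_eq_abs, abs_of_nonneg (by positivity)]
      exact pow_le_pow_left₀ (norm_nonneg _) (hBQ _ _ (hδ0 t)) 2
  have hI_a : IntervalIntegrable (fun t ↦ 2 * ‖dirPoly (Nat.primesLE N) w 0 a t -
      dirPoly (Nat.primesLE N) w₂ 0 0 t‖ ^ 2) volume (T / 2) T :=
    ((((continuous_dirPoly_right hS0 w 0 a).sub hEc).norm.pow 2).const_mul 2).intervalIntegrable _ _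
  have hI_g : IntervalIntegrable (fun t ↦ 2 * (SelbergSigma.delta ℓ t ^ 2 * g t)) volume (T / 2) T := by
    refine intervalIntegrable_of_bounded ?_ hTT (M := 2 * (1 * Bg)) fun t ht ↦ ?_
    · exact ((hδm.pow_const 2).mul hgc.measurable).const_mul 2
    · have h1 : SelbergSigma.delta ℓ t ^ 2 ≤ 1 := pow_le_one₀ (hδ0 t) (hδ1 t)
      have h2 := hBg t (Ioc_subset_Icc_self ht)
      rw [Real.norm_eq_abs] at h2
      have h3 : g t ≤ Bg := (le_abs_self _).trans h2
      have h4 : 0 ≤ g t := by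
        rw [hg_eq t]
        exact intervalIntegral.integral_nonneg ha1 fun u _ ↦ mul_nonneg (hψ0 u) (hH0 u t)
      rw [Real.norm_eq_abs, abs_of_nonneg (mul_nonneg (by norm_num) (mul_nonneg (sq_nonneg _) h4))]
      exact mul_le_mul_of_nonneg_left (mul_le_mul h1 h3 h4 zero_le_one) (by norm_num)
  have hstep2 : ∫ t in T / 2..T, ‖dirPoly (Nat.primesLE N) w 0 (SelbergSigma.delta ℓ t) t - dirPoly (Nat.primesLE N) w₂ 0 0 t‖ ^ 2 ≤
      2 * (∫ t in T / 2..T, ‖dirPoly (Nat.primesLE N) w 0 a t - dirPoly (Nat.primesLE N) w₂ 0 0 t‖ ^ 2) +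
        2 * (∫ t in T / 2..T, SelbergSigma.delta ℓ t ^ 2 * g t) := by
    calc ∫ t in T / 2..T, ‖dirPoly (Nat.primesLE N) w 0 (SelbergSigma.delta ℓ t) t - dirPoly (Nat.primesLE N) w₂ 0 0 t‖ ^ 2
        ≤ ∫ t in T / 2..T, (2 * ‖dirPoly (Nat.primesLE N) w 0 a t - dirPoly (Nat.primesLE N) w₂ 0 0 t‖ ^ 2 +
            2 * (SelbergSigma.delta ℓ t ^ 2 * g t)) :=
          intervalIntegral.integral_mono_on hTT hI_lhs (hI_a.add hI_g) fun t _ ↦ hSM t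
      _ = _ := by
          rw [intervalIntegral.integral_add hI_a hI_g, intervalIntegral.integral_const_mul,
            intervalIntegral.integral_const_mul]
  -- Step 3: Fubini–Cauchy–Schwarz
  set T'' : ℝ := T / 2 + 8 * (N : ℝ) ^ 2 * (1 + Real.log ((N : ℝ) ^ 2)) with hT''
  have hlogN : 0 ≤ Real.log ((N : ℝ) ^ 2) := by rw [← Nat.cast_pow]; exact Real.log_natCast_nonneg _
  have hT''0 : 0 ≤ T'' := by positivity
  have hT''T : T'' ≤ T := by rw [hT'']; linarith
  obtain ⟨G, hG⟩ : ∃ G : ℝ → ℝ, G = fun u ↦ T'' * (2 * (60 / (max u a) ^ 2) ^ 2) := ⟨_, rfl⟩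
  have hG_eq : ∀ u, G u = T'' * (2 * (60 / (max u a) ^ 2) ^ 2) := fun u ↦ by rw [hG]
  have hGc : Continuous G := by
    rw [hG]
    refine continuous_const.mul (continuous_const.mul ((continuous_const.div
      ((continuous_id.max continuous_const).pow 2) fun u ↦ ?_).pow 2))
    exact pow_ne_zero _ (lt_of_lt_of_le ha0 (le_max_right u a)).ne'
  have hΦ : ∫ t in T / 2..T, (SelbergSigma.delta ℓ t ^ 2) ^ 2 ≤ Φ₄ := by
    have : ∫ t in T / 2..T, (SelbergSigma.delta ℓ t ^ 2) ^ 2 = ∫ t in T / 2..T, SelbergSigma.delta ℓ t ^ 4 :=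
      intervalIntegral.integral_congr fun t _ ↦ by ring
    rw [this]; exact h4
  have hHG : ∀ u ∈ Icc a 1, ∫ t in T / 2..T, H u t ^ 2 ≤ G u := by
    intro u hu
    have hu0 : 0 < u := ha0.trans_le hu.1
    have e1 : ∫ t in T / 2..T, H u t ^ 2 = ∫ t in T / 2..T, ‖dirPoly (Nat.primesLE N) w 1 u t‖ ^ 4 :=
      intervalIntegral.integral_congr fun t _ ↦ by rw [hH_eq]; ring
    rw [e1, hG_eq, max_eq_left hu.1]
    exact integral_norm_P1_pow_four_le hw hu0 hu.2 hT
  have hFCS := integral_mul_integral_le hTT ha1 (φ := fun t ↦ SelbergSigma.delta ℓ t ^ 2) (hδm.pow_const 2)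
    (fun t ↦ sq_nonneg _) (Bφ := 1) (fun t ↦ pow_le_one₀ (hδ0 t) (hδ1 t))
    hψm hψc.continuousOn (fun u _ ↦ hψ0 u) (fun u _ ↦ hψB u) hHc hH0 hΦ hGc.continuousOn hHG
  -- Step 4: evaluate `∫_a^1 ψ √G = 60 √(2T'') ∫_a^1 u^{-3}`
  have heval : ∫ u in a..1, ψ u * Real.sqrt (G u) = 60 * Real.sqrt (2 * T'') * ∫ u in a..1, (u ^ 3)⁻¹ := by
    rw [← intervalIntegral.integral_const_mul]
    refine intervalIntegral.integral_congr fun u hu ↦ ?_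
    rw [uIcc_of_le ha1] at hu
    have hu0 : 0 < u := ha0.trans_le hu.1
    rw [hψ_eq u hu, hG_eq, max_eq_left hu.1, sqrt_mul_two_mul_sq hT''0 (by positivity)]
    field_simp
  have hint3 := integral_inv_pow_three_le ha0 ha1
  have hsq2T : Real.sqrt (2 * T'') ≤ Real.sqrt 2 * Real.sqrt T := by
    rw [← Real.sqrt_mul (by norm_num)]; exact Real.sqrt_le_sqrt (by linarith)
  have hs2 : Real.sqrt 2 ≤ 1.42 := by
    rw [Real.sqrt_le_left (by norm_num)]; norm_num
  have hstep4 : Real.sqrt Φ₄ * ∫ u in a..1, ψ u * Real.sqrt (G u) ≤ 4 * Real.sqrt Φ₄ * Real.sqrt T * ℓ ^ 2 := by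
    rw [heval]
    have ha2 : 1 / (2 * a ^ 2) = ℓ ^ 2 / 32 := by rw [ha]; field_simp; ring
    have h0 : 0 ≤ ∫ u in a..1, (u ^ 3)⁻¹ :=
      intervalIntegral.integral_nonneg ha1 fun u hu ↦ inv_nonneg.2 (pow_nonneg (ha0.le.trans hu.1) 3)
    have h1 : 60 * Real.sqrt (2 * T'') * ∫ u in a..1, (u ^ 3)⁻¹ ≤
        60 * (Real.sqrt 2 * Real.sqrt T) * (ℓ ^ 2 / 32) := by
      rw [← ha2]
      exact mul_le_mul (mul_le_mul_of_nonneg_left hsq2T (by norm_num)) hint3 h0 (by positivity)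
    calc Real.sqrt Φ₄ * (60 * Real.sqrt (2 * T'') * ∫ u in a..1, (u ^ 3)⁻¹)
        ≤ Real.sqrt Φ₄ * (60 * (Real.sqrt 2 * Real.sqrt T) * (ℓ ^ 2 / 32)) :=
          mul_le_mul_of_nonneg_left h1 (Real.sqrt_nonneg _)
      _ ≤ Real.sqrt Φ₄ * (60 * (1.42 * Real.sqrt T) * (ℓ ^ 2 / 32)) := by gcongr
      _ ≤ 4 * Real.sqrt Φ₄ * Real.sqrt T * ℓ ^ 2 := by
          have : 0 ≤ Real.sqrt Φ₄ * Real.sqrt T * ℓ ^ 2 := by positivity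
          nlinarith
  -- conclusion
  have hfinal : ∫ t in T / 2..T, SelbergSigma.delta ℓ t ^ 2 * g t ≤ 4 * Real.sqrt Φ₄ * Real.sqrt T * ℓ ^ 2 := by
    have e : ∫ t in T / 2..T, SelbergSigma.delta ℓ t ^ 2 * g t = ∫ t in T / 2..T, SelbergSigma.delta ℓ t ^ 2 * ∫ u in a..1, ψ u * H u t :=
      intervalIntegral.integral_congr fun t _ ↦ by rw [hg_eq]
    rw [e]
    exact hFCS.trans hstep4
  calc ∫ t in T / 2..T, ‖dirPoly (Nat.primesLE N) w 0 (SelbergSigma.delta ℓ t) t - dirPoly (Nat.primesLE N) w₂ 0 0 t‖ ^ 2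
      ≤ 2 * (∫ t in T / 2..T, ‖dirPoly (Nat.primesLE N) w 0 a t - dirPoly (Nat.primesLE N) w₂ 0 0 t‖ ^ 2) +
          2 * (∫ t in T / 2..T, SelbergSigma.delta ℓ t ^ 2 * g t) := hstep2
    _ ≤ 2 * (∫ t in T / 2..T, ‖dirPoly (Nat.primesLE N) w 0 a t - dirPoly (Nat.primesLE N) w₂ 0 0 t‖ ^ 2) +
          2 * (4 * Real.sqrt Φ₄ * Real.sqrt T * ℓ ^ 2) :=
        add_le_add le_rfl (mul_le_mul_of_nonneg_left hfinal (by norm_num : (0 : ℝ) ≤ 2))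
    _ = _ := by ring

/-! ### §5 Removing the moving abscissa: the prime part of `D`, weighted by `δ²` -/

set_option maxHeartbeats 4000000 in
/-- **Removing the moving abscissa, II (the prime part of `D`, with the weight `δ²`).** With the
notation of `integral_norm_sq_moving_sub_le` and `∫_{T/2}^{T} δ⁶ ≤ Φ₆`:
`∫_{T/2}^{T} δ(t)² ‖P₁(w; δ(t), t)‖² dt ≤ 11 √Φ₄ √T ℓ² + 6 √Φ₆ √T ℓ³`:
Sobolev–Markov with `m = 0` gives `δ²‖P₁(δ)‖² ≤ 2δ²‖P₁(a)‖² + 2δ³ ∫_a^1 ‖P₂(u)‖² du`; the first term is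
handled by Cauchy–Schwarz (`∫ δ⁴ ≤ Φ₄`, `∫ ‖P₁(a,·)‖⁴ ≤ 2T (60/a²)²`), the second by
Fubini–Cauchy–Schwarz (`∫ δ⁶ ≤ Φ₆`, `∫ ‖P₂(u,·)‖⁴ ≤ 2T (360/u⁴)²`, `∫_a^1 u^{−4} ≤ 1/(3a³)`).
[cite: Titchmarsh1986, §14.22] -/
theorem integral_delta_sq_mul_norm_sq_le {N : ℕ} (w : ℕ → ℝ) (hw : ∀ p, |w p| ≤ 1) {ℓ T Φ₄ Φ₆ : ℝ}
    (hℓ : 4 < ℓ) (hT : 0 ≤ T) (hsize : 8 * (N : ℝ) ^ 2 * (1 + Real.log ((N : ℝ) ^ 2)) ≤ T / 2)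
    (h4 : ∫ t in T / 2..T, SelbergSigma.delta ℓ t ^ 4 ≤ Φ₄)
    (h6 : ∫ t in T / 2..T, SelbergSigma.delta ℓ t ^ 6 ≤ Φ₆) :
    ∫ t in T / 2..T, SelbergSigma.delta ℓ t ^ 2 *
        ‖dirPoly (Nat.primesLE N) w 1 (SelbergSigma.delta ℓ t) t‖ ^ 2 ≤
      11 * Real.sqrt Φ₄ * Real.sqrt T * ℓ ^ 2 + 6 * Real.sqrt Φ₆ * Real.sqrt T * ℓ ^ 3 := by
  have hS0 : ∀ n ∈ Nat.primesLE N, n ≠ 0 := fun n hn ↦ (Nat.mem_primesLE.1 hn).2.ne_zero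
  set a : ℝ := 4 / ℓ with ha
  have hℓ0 : 0 < ℓ := by linarith
  have ha0 : 0 < a := by positivity
  have ha1 : a ≤ 1 := by rw [ha, div_le_one hℓ0]; linarith
  have hδa : ∀ t, a ≤ SelbergSigma.delta ℓ t := fun t ↦ SelbergSigma.four_div_le_delta ℓ t
  have hδ1 : ∀ t, SelbergSigma.delta ℓ t ≤ 1 := fun t ↦ (SelbergSigma.delta_lt_one hℓ t).le
  have hδ0 : ∀ t, 0 ≤ SelbergSigma.delta ℓ t := fun t ↦ ha0.le.trans (hδa t)
  have hδm : Measurable fun t ↦ SelbergSigma.delta ℓ t := SelbergSigma.measurable_delta ℓ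
  have hδpow1 : ∀ t (k : ℕ), SelbergSigma.delta ℓ t ^ k ≤ 1 := fun t k ↦ pow_le_one₀ (hδ0 t) (hδ1 t)
  have hTT : T / 2 ≤ T := by linarith
  set T'' : ℝ := T / 2 + 8 * (N : ℝ) ^ 2 * (1 + Real.log ((N : ℝ) ^ 2)) with hT''
  have hlogN : 0 ≤ Real.log ((N : ℝ) ^ 2) := by rw [← Nat.cast_pow]; exact Real.log_natCast_nonneg _
  have hT''0 : 0 ≤ T'' := by positivity
  have hT''T : T'' ≤ T := by rw [hT'']; linarith
  have hsq2T : Real.sqrt (2 * T'') ≤ Real.sqrt 2 * Real.sqrt T := by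
    rw [← Real.sqrt_mul (by norm_num)]; exact Real.sqrt_le_sqrt (by linarith)
  have hs2 : Real.sqrt 2 ≤ 1.42 := by
    rw [Real.sqrt_le_left (by norm_num)]; norm_num
  -- the auxiliary functions `H(u, t) = ‖P₂(u, t)‖²`, `g(t) = ∫_a^1 H`
  obtain ⟨H, hH⟩ : ∃ H : ℝ → ℝ → ℝ, H = fun u t ↦ ‖dirPoly (Nat.primesLE N) w 2 u t‖ ^ 2 := ⟨_, rfl⟩
  obtain ⟨g, hg⟩ : ∃ g : ℝ → ℝ, g = fun t ↦ ∫ u in a..1, (1 : ℝ) * H u t := ⟨_, rfl⟩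
  have hHc : Continuous (Function.uncurry H) := by
    rw [hH]; exact ((continuous_dirPoly hS0 w 2).norm).pow 2
  have hH0 : ∀ u t, 0 ≤ H u t := fun u t ↦ by rw [hH]; positivity
  have hH_eq : ∀ u t, H u t = ‖dirPoly (Nat.primesLE N) w 2 u t‖ ^ 2 := fun u t ↦ by rw [hH]
  have hgc : Continuous g := by
    have : Continuous (Function.uncurry fun t u ↦ (1 : ℝ) * H u t) :=
      continuous_const.mul (hHc.comp (continuous_snd.prodMk continuous_fst))
    rw [hg]
    exact intervalIntegral.continuous_parametric_intervalIntegral_of_continuous' this a 1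
  have hg_eq : ∀ t, g t = ∫ u in a..1, (1 : ℝ) * H u t := fun t ↦ by rw [hg]
  have hg0 : ∀ t, 0 ≤ g t := fun t ↦ by
    rw [hg_eq]
    exact intervalIntegral.integral_nonneg ha1 fun u _ ↦ by rw [one_mul]; exact hH0 u t
  -- Step 1: pointwise
  have hSM : ∀ t, SelbergSigma.delta ℓ t ^ 2 * ‖dirPoly (Nat.primesLE N) w 1 (SelbergSigma.delta ℓ t) t‖ ^ 2 ≤
      2 * (SelbergSigma.delta ℓ t ^ 2 * ‖dirPoly (Nat.primesLE N) w 1 a t‖ ^ 2) + 2 * (SelbergSigma.delta ℓ t ^ 3 * g t) := by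
    intro t
    have h := norm_sq_le_sobolev_markov (Q := fun u ↦ dirPoly (Nat.primesLE N) w 1 u t)
      (Q' := fun u ↦ dirPoly (Nat.primesLE N) w 2 u t) ha0 (hδa t) (hδ1 t)
      (fun u _ ↦ hasDerivAt_dirPoly (Nat.primesLE N) w 1 u t)
      (continuous_dirPoly_left (Nat.primesLE N) w 2 t).continuousOn 0
    have e : ∫ u in a..1, SelbergSigma.delta ℓ t ^ (0 + 1) / u ^ 0 * ‖dirPoly (Nat.primesLE N) w 2 u t‖ ^ 2 = SelbergSigma.delta ℓ t * g t := by
      rw [hg_eq, ← intervalIntegral.integral_const_mul]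
      refine intervalIntegral.integral_congr fun u _ ↦ ?_
      rw [hH_eq]; ring
    rw [e] at h
    have hd2 : 0 ≤ SelbergSigma.delta ℓ t ^ 2 := sq_nonneg _
    calc SelbergSigma.delta ℓ t ^ 2 * ‖dirPoly (Nat.primesLE N) w 1 (SelbergSigma.delta ℓ t) t‖ ^ 2
        ≤ SelbergSigma.delta ℓ t ^ 2 * (2 * ‖dirPoly (Nat.primesLE N) w 1 a t‖ ^ 2 + 2 * (SelbergSigma.delta ℓ t * g t)) :=
          mul_le_mul_of_nonneg_left h hd2
      _ = 2 * (SelbergSigma.delta ℓ t ^ 2 * ‖dirPoly (Nat.primesLE N) w 1 a t‖ ^ 2) + 2 * (SelbergSigma.delta ℓ t ^ 3 * g t) := by ring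
  -- Step 2: integrate
  obtain ⟨Bg, hBg⟩ := (isCompact_Icc (a := T / 2) (b := T)).exists_bound_of_continuousOn hgc.continuousOn
  set BQ := ∑ p ∈ Nat.primesLE N, Real.log p ^ 1 * |w p| with hBQdef
  have hBQ : ∀ u t, 0 ≤ u → ‖dirPoly (Nat.primesLE N) w 1 u t‖ ≤ BQ := fun u t hu ↦
    norm_dirPoly_le hS0 w 1 (by linarith) t
  have hBQ0 : 0 ≤ BQ := (norm_nonneg _).trans (hBQ 0 0 le_rfl)
  have hQac : Continuous fun t ↦ dirPoly (Nat.primesLE N) w 1 a t := continuous_dirPoly_right hS0 w 1 a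
  have hI_lhs : IntervalIntegrable (fun t ↦ SelbergSigma.delta ℓ t ^ 2 * ‖dirPoly (Nat.primesLE N) w 1 (SelbergSigma.delta ℓ t) t‖ ^ 2)
      volume (T / 2) T := by
    refine intervalIntegrable_of_bounded ?_ hTT (M := 1 * BQ ^ 2) fun t _ ↦ ?_
    · exact (hδm.pow_const 2).mul ((measurable_dirPoly_comp hS0 w 1 hδm).norm.pow_const 2)
    · rw [Real.norm_eq_abs, abs_of_nonneg (by positivity)]
      exact mul_le_mul (hδpow1 t 2) (pow_le_pow_left₀ (norm_nonneg _) (hBQ _ _ (hδ0 t)) 2)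
        (by positivity) zero_le_one
  have hI_a : IntervalIntegrable (fun t ↦ 2 * (SelbergSigma.delta ℓ t ^ 2 * ‖dirPoly (Nat.primesLE N) w 1 a t‖ ^ 2))
      volume (T / 2) T := by
    refine intervalIntegrable_of_bounded ?_ hTT (M := 2 * (1 * BQ ^ 2)) fun t _ ↦ ?_
    · exact ((hδm.pow_const 2).mul (hQac.norm.measurable.pow_const 2)).const_mul 2
    · rw [Real.norm_eq_abs, abs_of_nonneg (by positivity)]
      refine mul_le_mul_of_nonneg_left ?_ (by norm_num)
      exact mul_le_mul (hδpow1 t 2) (pow_le_pow_left₀ (norm_nonneg _) (hBQ _ _ ha0.le) 2)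
        (by positivity) zero_le_one
  have hI_g : IntervalIntegrable (fun t ↦ 2 * (SelbergSigma.delta ℓ t ^ 3 * g t)) volume (T / 2) T := by
    refine intervalIntegrable_of_bounded ?_ hTT (M := 2 * (1 * Bg)) fun t ht ↦ ?_
    · exact ((hδm.pow_const 3).mul hgc.measurable).const_mul 2
    · have h2 := hBg t (Ioc_subset_Icc_self ht)
      rw [Real.norm_eq_abs, abs_of_nonneg (hg0 t)] at h2
      rw [Real.norm_eq_abs, abs_of_nonneg (mul_nonneg (by norm_num)
        (mul_nonneg (pow_nonneg (hδ0 t) 3) (hg0 t)))]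
      exact mul_le_mul_of_nonneg_left (mul_le_mul (hδpow1 t 3) h2 (hg0 t) zero_le_one) (by norm_num)
  have hstep2 : ∫ t in T / 2..T, SelbergSigma.delta ℓ t ^ 2 * ‖dirPoly (Nat.primesLE N) w 1 (SelbergSigma.delta ℓ t) t‖ ^ 2 ≤
      2 * (∫ t in T / 2..T, SelbergSigma.delta ℓ t ^ 2 * ‖dirPoly (Nat.primesLE N) w 1 a t‖ ^ 2) +
        2 * (∫ t in T / 2..T, SelbergSigma.delta ℓ t ^ 3 * g t) := by
    calc ∫ t in T / 2..T, SelbergSigma.delta ℓ t ^ 2 * ‖dirPoly (Nat.primesLE N) w 1 (SelbergSigma.delta ℓ t) t‖ ^ 2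
        ≤ ∫ t in T / 2..T, (2 * (SelbergSigma.delta ℓ t ^ 2 * ‖dirPoly (Nat.primesLE N) w 1 a t‖ ^ 2) + 2 * (SelbergSigma.delta ℓ t ^ 3 * g t)) :=
          intervalIntegral.integral_mono_on hTT hI_lhs (hI_a.add hI_g) fun t _ ↦ hSM t
      _ = _ := by
          rw [intervalIntegral.integral_add hI_a hI_g, intervalIntegral.integral_const_mul,
            intervalIntegral.integral_const_mul]
  -- Step 3a: Cauchy–Schwarz for the first term
  have hΦ4 : ∫ t in T / 2..T, (SelbergSigma.delta ℓ t ^ 2) ^ 2 ≤ Φ₄ := by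
    have : ∫ t in T / 2..T, (SelbergSigma.delta ℓ t ^ 2) ^ 2 = ∫ t in T / 2..T, SelbergSigma.delta ℓ t ^ 4 :=
      intervalIntegral.integral_congr fun t _ ↦ by ring
    rw [this]; exact h4
  have hfirst : ∫ t in T / 2..T, SelbergSigma.delta ℓ t ^ 2 * ‖dirPoly (Nat.primesLE N) w 1 a t‖ ^ 2 ≤
      Real.sqrt Φ₄ * (Real.sqrt (2 * T'') * (60 / a ^ 2)) := by
    have hCS := integral_mul_le_sqrt_mul_sqrt hTT (f := fun t ↦ SelbergSigma.delta ℓ t ^ 2)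
      (g := fun t ↦ ‖dirPoly (Nat.primesLE N) w 1 a t‖ ^ 2)
      (hδm.pow_const 2) (hQac.norm.measurable.pow_const 2) (fun t ↦ sq_nonneg _) (fun t ↦ sq_nonneg _)
      (B := max 1 (BQ ^ 2)) (fun t _ ↦ (hδpow1 t 2).trans (le_max_left _ _))
      (fun t _ ↦ (pow_le_pow_left₀ (norm_nonneg _) (hBQ _ _ ha0.le) 2).trans (le_max_right _ _))
    refine hCS.trans (mul_le_mul (Real.sqrt_le_sqrt hΦ4) ?_ (Real.sqrt_nonneg _) (Real.sqrt_nonneg _))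
    have e1 : ∫ t in T / 2..T, (‖dirPoly (Nat.primesLE N) w 1 a t‖ ^ 2) ^ 2 =
        ∫ t in T / 2..T, ‖dirPoly (Nat.primesLE N) w 1 a t‖ ^ 4 :=
      intervalIntegral.integral_congr fun t _ ↦ by ring
    rw [e1, ← sqrt_mul_two_mul_sq hT''0 (by positivity)]
    exact Real.sqrt_le_sqrt (integral_norm_P1_pow_four_le hw ha0 ha1 hT)
  -- Step 3b: Fubini–Cauchy–Schwarz for the second term
  obtain ⟨G, hG⟩ : ∃ G : ℝ → ℝ, G = fun u ↦ T'' * (2 * (360 / (max u a) ^ 4) ^ 2) := ⟨_, rfl⟩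
  have hG_eq : ∀ u, G u = T'' * (2 * (360 / (max u a) ^ 4) ^ 2) := fun u ↦ by rw [hG]
  have hGc : Continuous G := by
    rw [hG]
    refine continuous_const.mul (continuous_const.mul ((continuous_const.div
      ((continuous_id.max continuous_const).pow 4) fun u ↦ ?_).pow 2))
    exact pow_ne_zero _ (lt_of_lt_of_le ha0 (le_max_right u a)).ne'
  have hΦ6 : ∫ t in T / 2..T, (SelbergSigma.delta ℓ t ^ 3) ^ 2 ≤ Φ₆ := by
    have : ∫ t in T / 2..T, (SelbergSigma.delta ℓ t ^ 3) ^ 2 = ∫ t in T / 2..T, SelbergSigma.delta ℓ t ^ 6 :=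
      intervalIntegral.integral_congr fun t _ ↦ by ring
    rw [this]; exact h6
  have hHG : ∀ u ∈ Icc a 1, ∫ t in T / 2..T, H u t ^ 2 ≤ G u := by
    intro u hu
    have hu0 : 0 < u := ha0.trans_le hu.1
    have e1 : ∫ t in T / 2..T, H u t ^ 2 = ∫ t in T / 2..T, ‖dirPoly (Nat.primesLE N) w 2 u t‖ ^ 4 :=
      intervalIntegral.integral_congr fun t _ ↦ by rw [hH_eq]; ring
    rw [e1, hG_eq, max_eq_left hu.1]
    exact integral_norm_P2_pow_four_le hw hu0 hu.2 hT
  have hFCS := integral_mul_integral_le hTT ha1 (φ := fun t ↦ SelbergSigma.delta ℓ t ^ 3) (hδm.pow_const 3)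
    (fun t ↦ pow_nonneg (hδ0 t) 3) (Bφ := 1) (fun t ↦ hδpow1 t 3)
    (ψ := fun _ ↦ (1 : ℝ)) measurable_const continuousOn_const (fun u _ ↦ zero_le_one) (Bψ := 1)
    (fun u _ ↦ le_rfl) hHc hH0 hΦ6 hGc.continuousOn hHG
  have heval : ∫ u in a..1, (1 : ℝ) * Real.sqrt (G u) = 360 * Real.sqrt (2 * T'') * ∫ u in a..1, (u ^ 4)⁻¹ := by
    rw [← intervalIntegral.integral_const_mul]
    refine intervalIntegral.integral_congr fun u hu ↦ ?_
    rw [uIcc_of_le ha1] at hu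
    have hu0 : 0 < u := ha0.trans_le hu.1
    rw [hG_eq, max_eq_left hu.1, sqrt_mul_two_mul_sq hT''0 (by positivity)]
    field_simp
  have hint4 := integral_inv_pow_four_le ha0 ha1
  have hsecond : Real.sqrt Φ₆ * ∫ u in a..1, (1 : ℝ) * Real.sqrt (G u) ≤ 3 * Real.sqrt Φ₆ * Real.sqrt T * ℓ ^ 3 := by
    rw [heval]
    have ha3 : 1 / (3 * a ^ 3) = ℓ ^ 3 / 192 := by rw [ha]; field_simp; ring
    have h0 : 0 ≤ ∫ u in a..1, (u ^ 4)⁻¹ :=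
      intervalIntegral.integral_nonneg ha1 fun u hu ↦ inv_nonneg.2 (pow_nonneg (ha0.le.trans hu.1) 4)
    have h1 : 360 * Real.sqrt (2 * T'') * ∫ u in a..1, (u ^ 4)⁻¹ ≤
        360 * (Real.sqrt 2 * Real.sqrt T) * (ℓ ^ 3 / 192) := by
      rw [← ha3]
      exact mul_le_mul (mul_le_mul_of_nonneg_left hsq2T (by norm_num)) hint4 h0 (by positivity)
    calc Real.sqrt Φ₆ * (360 * Real.sqrt (2 * T'') * ∫ u in a..1, (u ^ 4)⁻¹)
        ≤ Real.sqrt Φ₆ * (360 * (Real.sqrt 2 * Real.sqrt T) * (ℓ ^ 3 / 192)) :=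
          mul_le_mul_of_nonneg_left h1 (Real.sqrt_nonneg _)
      _ ≤ Real.sqrt Φ₆ * (360 * (1.42 * Real.sqrt T) * (ℓ ^ 3 / 192)) := by gcongr
      _ ≤ 3 * Real.sqrt Φ₆ * Real.sqrt T * ℓ ^ 3 := by
          have : 0 ≤ Real.sqrt Φ₆ * Real.sqrt T * ℓ ^ 3 := by positivity
          nlinarith
  -- conclusion
  have hfirst' : ∫ t in T / 2..T, SelbergSigma.delta ℓ t ^ 2 * ‖dirPoly (Nat.primesLE N) w 1 a t‖ ^ 2 ≤
      (11 / 2) * Real.sqrt Φ₄ * Real.sqrt T * ℓ ^ 2 := by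
    refine hfirst.trans ?_
    have ha2 : 60 / a ^ 2 = 60 * ℓ ^ 2 / 16 := by rw [ha]; field_simp; ring
    rw [ha2]
    calc Real.sqrt Φ₄ * (Real.sqrt (2 * T'') * (60 * ℓ ^ 2 / 16))
        ≤ Real.sqrt Φ₄ * ((Real.sqrt 2 * Real.sqrt T) * (60 * ℓ ^ 2 / 16)) := by gcongr
      _ ≤ Real.sqrt Φ₄ * ((1.42 * Real.sqrt T) * (60 * ℓ ^ 2 / 16)) := by gcongr
      _ ≤ (11 / 2) * Real.sqrt Φ₄ * Real.sqrt T * ℓ ^ 2 := by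
          have : 0 ≤ Real.sqrt Φ₄ * Real.sqrt T * ℓ ^ 2 := by positivity
          nlinarith
  have hsecond' : ∫ t in T / 2..T, SelbergSigma.delta ℓ t ^ 3 * g t ≤ 3 * Real.sqrt Φ₆ * Real.sqrt T * ℓ ^ 3 := by
    have e : ∫ t in T / 2..T, SelbergSigma.delta ℓ t ^ 3 * g t = ∫ t in T / 2..T, SelbergSigma.delta ℓ t ^ 3 * ∫ u in a..1, (1 : ℝ) * H u t :=
      intervalIntegral.integral_congr fun t _ ↦ by rw [hg_eq]
    rw [e]
    exact hFCS.trans hsecond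
  calc ∫ t in T / 2..T, SelbergSigma.delta ℓ t ^ 2 * ‖dirPoly (Nat.primesLE N) w 1 (SelbergSigma.delta ℓ t) t‖ ^ 2
      ≤ 2 * (∫ t in T / 2..T, SelbergSigma.delta ℓ t ^ 2 * ‖dirPoly (Nat.primesLE N) w 1 a t‖ ^ 2) +
          2 * (∫ t in T / 2..T, SelbergSigma.delta ℓ t ^ 3 * g t) := hstep2
    _ ≤ 2 * ((11 / 2) * Real.sqrt Φ₄ * Real.sqrt T * ℓ ^ 2) + 2 * (3 * Real.sqrt Φ₆ * Real.sqrt T * ℓ ^ 3) :=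
        add_le_add (mul_le_mul_of_nonneg_left hfirst' (by norm_num : (0 : ℝ) ≤ 2))
          (mul_le_mul_of_nonneg_left hsecond' (by norm_num : (0 : ℝ) ≤ 2))
    _ = 11 * Real.sqrt Φ₄ * Real.sqrt T * ℓ ^ 2 + 6 * Real.sqrt Φ₆ * Real.sqrt T * ℓ ^ 3 := by ring

end SelbergMeanSquare

end Literature.NumberTheory.LFunctions

end
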